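import Summits.BirchSwinnertonDyer.Rank1Residual.Additive.X3ThreeLineDatum
import Summits.BirchSwinnertonDyer.Rank1Residual.X2.CellAGVParCertificatesN9A
import Mathlib.Tactic.Simproc.Factors
import HarnessLib

/-!
# X3♯(G-ord, `e = 2`) at `p = 3`: kernel records of the per-pair LINE DATUM `X3LineDatumThree W` for the
# Case-1 members of the B-X3G booking list — part I of 16 (cell `bsd-addord`, seat
# `bsd-addord-twist`, strategy = twist transport)

HONEST FRAMING (cell `bsd-addord`, `run/shared/lean/pub/bsd-addord/README.md` §4): the programme's
target of record is the full Birch–Swinnerton-Dyer formula for every `E/ℚ` of analytic rank `≤ 1`.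
DATA-RECORDS module: theorems only (no definition, no named fact, no `sorry`); it BOOKS NOTHING and
moves no mark — booking is the planner's act (TARGET.md v5.5 §8 protocol B-X3G, (iv)).

## What is recorded

For each isogeny class `(N, class, 3)` of the booking list `HOME/bsd-addord-twist-booking-members.tsv`
(kit job j242057; the r_an = 0, non-CM, non-degenerate branch-parity classes of cell (G-ord, `e = 2`) at
`p = 3` in census v2, planner keys `HOME/planner/bx3g/`), the CASE-1 MEMBER `W = [a₁, a₂, a₃, a₄, a₆]`
(Cremona's globally minimal model; the first member in Cremona order carrying the EVEN rational `3`-line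
as a SUB-line) and the theorem `X3LineDatumThree W` — SOME rational `3`-line `Φ₀ ≤ W[3]` which is even,
has non-trivial `Γ_ℚ`-action and `χ_{−3}`-twist ramified at `3` — proved by
`x3LineDatumThree_of_cert_of_delta` from the certificate `(x₀, s, D, q)`: `Ψ₃(x₀) = 0`, `D` squarefree,
`s ≠ 0`, `D·s² = Ψ₂Sq(x₀)`, `0 < D`, `D ≠ 1`, `3 ∤ D` (`norm_num` identities, one prime-factor-list
computation with X2a's helper `squarefree_of_nodup_primeFactorsList_natAbs`, `decide`s). This is the per-pair line-datum input of
`ClassX3Gord.{{missingLowerBoundAt,bsdp}}_three_rankZero_of_facts_of_nonAnomalous`; the class binders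
(`ClassX3Gord W 3`, `¬ HasCM`, `analyticRank = 0`, `ReductionNonAnomalous W 3`) are data of record
(Cremona / the planner's two-engine census), NOT kernel statements here; the other members of each class
are reached by Cassels (`N10.bsdp_of_isIsogenous_of_bsdp`, binder `bsdRHS_eq_of_isIsogenous`). The
docstring of each record names the class, the anomalous bit of the twist `V = W ⊗ χ_{−3}` and `D`
(`φ = χ_D`). Records sorted by conductor.

References: [GreenbergVatsal2000] §2 p. 28 (the line `Φ`); lane file
`HOME/bsd-addord-twist-booking-members.tsv`; `Additive/X3ThreeLineDatum.lean`.
-/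

set_option autoImplicit false

open WeierstrassCurve Polynomial Literature.NumberTheory.EllipticCurves
  Literature.NumberTheory.EllipticCurves.Rank1Residual

namespace Summit.BirchSwinnertonDyer.Rank1Residual.Additive.X3ThreeLineDatumRecords

/-- `222300x2` = `[0,0,0,-137714925,-673879942375]` (class `222300x`, (G-ord, `e = 2`) at `3`; twist `24700e2`, `a₃(V) = 2`, non-anomalous; even line
`φ = χ_{5}`): `x₀ = 20535`, `D = 5`, `s = 2031250`, `Ψ₂Sq(x₀) = 20629882812500` ⇒ `X3LineDatumThree W`. [folklore] -/
theorem x3LineDatumThree_222300x2 : X3LineDatumThree (⟨0, 0, 0, -137714925, -673879942375⟩ : WeierstrassCurve ℚ) :=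
  x3LineDatumThree_of_cert_of_delta _ (by norm_num [Δ, b₂, b₄, b₆, b₈]) 20535 2031250 5
    (by simp only [Ψ₃, eval_add, eval_mul, eval_pow, eval_C, eval_X, eval_ofNat]; norm_num [b₂, b₄, b₆, b₈])
    (X2.CellACertN9.squarefree_of_nodup_primeFactorsList_natAbs (by norm_num) (by simp [Nat.primeFactorsList_ofNat])) (by norm_num)
    (by rw [KernelDisc.eval_Ψ₂Sq]; norm_num [b₂, b₄, b₆]) (by decide) (by decide) (by decide)

/-- `222525q2` = `[0,0,1,49537950,-9615768719]` (class `222525q`, (G-ord, `e = 2`) at `3`; twist `24725e2`, `a₃(V) = 2`, non-anomalous; even line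
`φ = χ_{5}`): `x₀ = 2940`, `D = 5`, `s = 359375`, `Ψ₂Sq(x₀) = 645751953125` ⇒ `X3LineDatumThree W`. [folklore] -/
theorem x3LineDatumThree_222525q2 : X3LineDatumThree (⟨0, 0, 1, 49537950, -9615768719⟩ : WeierstrassCurve ℚ) :=
  x3LineDatumThree_of_cert_of_delta _ (by norm_num [Δ, b₂, b₄, b₆, b₈]) 2940 359375 5
    (by simp only [Ψ₃, eval_add, eval_mul, eval_pow, eval_C, eval_X, eval_ofNat]; norm_num [b₂, b₄, b₆, b₈])
    (X2.CellACertN9.squarefree_of_nodup_primeFactorsList_natAbs (by norm_num) (by simp [Nat.primeFactorsList_ofNat])) (by norm_num)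
    (by rw [KernelDisc.eval_Ψ₂Sq]; norm_num [b₂, b₄, b₆]) (by decide) (by decide) (by decide)

/-- `223650cg3` = `[1,-1,1,-11744555,15494773947]` (class `223650cg`, (G-ord, `e = 2`) at `3`; twist `24850b3`, `a₃(V) = 2`, non-anomalous; even line
`φ = χ_{5}`): `x₀ = 1984`, `D = 5`, `s = 355`, `Ψ₂Sq(x₀) = 630125` ⇒ `X3LineDatumThree W`. [folklore] -/
theorem x3LineDatumThree_223650cg3 : X3LineDatumThree (⟨1, -1, 1, -11744555, 15494773947⟩ : WeierstrassCurve ℚ) :=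
  x3LineDatumThree_of_cert_of_delta _ (by norm_num [Δ, b₂, b₄, b₆, b₈]) 1984 355 5
    (by simp only [Ψ₃, eval_add, eval_mul, eval_pow, eval_C, eval_X, eval_ofNat]; norm_num [b₂, b₄, b₆, b₈])
    (X2.CellACertN9.squarefree_of_nodup_primeFactorsList_natAbs (by norm_num) (by simp [Nat.primeFactorsList_ofNat])) (by norm_num)
    (by rw [KernelDisc.eval_Ψ₂Sq]; norm_num [b₂, b₄, b₆]) (by decide) (by decide) (by decide)

/-- `223650fx2` = `[1,-1,0,-362367,133590541]` (class `223650fx`, (G-ord, `e = 2`) at `3`; twist `24850s2`, `a₃(V) = -1`, non-anomalous; even line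
`φ = χ_{5}`): `x₀ = 94`, `D = 5`, `s = 8960`, `Ψ₂Sq(x₀) = 401408000` ⇒ `X3LineDatumThree W`. [folklore] -/
theorem x3LineDatumThree_223650fx2 : X3LineDatumThree (⟨1, -1, 0, -362367, 133590541⟩ : WeierstrassCurve ℚ) :=
  x3LineDatumThree_of_cert_of_delta _ (by norm_num [Δ, b₂, b₄, b₆, b₈]) 94 8960 5
    (by simp only [Ψ₃, eval_add, eval_mul, eval_pow, eval_C, eval_X, eval_ofNat]; norm_num [b₂, b₄, b₆, b₈])
    (X2.CellACertN9.squarefree_of_nodup_primeFactorsList_natAbs (by norm_num) (by simp [Nat.primeFactorsList_ofNat])) (by norm_num)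
    (by rw [KernelDisc.eval_Ψ₂Sq]; norm_num [b₂, b₄, b₆]) (by decide) (by decide) (by decide)

/-- `223650ga2` = `[1,-1,0,-1068417,425287741]` (class `223650ga`, (G-ord, `e = 2`) at `3`; twist `24850t2`, `a₃(V) = 2`, non-anomalous; even line
`φ = χ_{5}`): `x₀ = 634`, `D = 5`, `s = 1400`, `Ψ₂Sq(x₀) = 9800000` ⇒ `X3LineDatumThree W`. [folklore] -/
theorem x3LineDatumThree_223650ga2 : X3LineDatumThree (⟨1, -1, 0, -1068417, 425287741⟩ : WeierstrassCurve ℚ) :=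
  x3LineDatumThree_of_cert_of_delta _ (by norm_num [Δ, b₂, b₄, b₆, b₈]) 634 1400 5
    (by simp only [Ψ₃, eval_add, eval_mul, eval_pow, eval_C, eval_X, eval_ofNat]; norm_num [b₂, b₄, b₆, b₈])
    (X2.CellACertN9.squarefree_of_nodup_primeFactorsList_natAbs (by norm_num) (by simp [Nat.primeFactorsList_ofNat])) (by norm_num)
    (by rw [KernelDisc.eval_Ψ₂Sq]; norm_num [b₂, b₄, b₆]) (by decide) (by decide) (by decide)

/-- `226512bd2` = `[0,0,0,-52140,4582523]` (class `226512bd`, (G-ord, `e = 2`) at `3`; twist `25168z2`, `a₃(V) = -1`, non-anomalous; even line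
`φ = χ_{11}`): `x₀ = 132`, `D = 11`, `s = 2`, `Ψ₂Sq(x₀) = 44` ⇒ `X3LineDatumThree W`. [folklore] -/
theorem x3LineDatumThree_226512bd2 : X3LineDatumThree (⟨0, 0, 0, -52140, 4582523⟩ : WeierstrassCurve ℚ) :=
  x3LineDatumThree_of_cert_of_delta _ (by norm_num [Δ, b₂, b₄, b₆, b₈]) 132 2 11
    (by simp only [Ψ₃, eval_add, eval_mul, eval_pow, eval_C, eval_X, eval_ofNat]; norm_num [b₂, b₄, b₆, b₈])
    (X2.CellACertN9.squarefree_of_nodup_primeFactorsList_natAbs (by norm_num) (by simp [Nat.primeFactorsList_ofNat])) (by norm_num)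
    (by rw [KernelDisc.eval_Ψ₂Sq]; norm_num [b₂, b₄, b₆]) (by decide) (by decide) (by decide)

/-- `226512bu2` = `[0,0,0,-690195,192444626]` (class `226512bu`, (G-ord, `e = 2`) at `3`; twist `25168x2`, `a₃(V) = -1`, non-anomalous; even line
`φ = χ_{11}`): `x₀ = 825`, `D = 11`, `s = 8192`, `Ψ₂Sq(x₀) = 738197504` ⇒ `X3LineDatumThree W`. [folklore] -/
theorem x3LineDatumThree_226512bu2 : X3LineDatumThree (⟨0, 0, 0, -690195, 192444626⟩ : WeierstrassCurve ℚ) :=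
  x3LineDatumThree_of_cert_of_delta _ (by norm_num [Δ, b₂, b₄, b₆, b₈]) 825 8192 11
    (by simp only [Ψ₃, eval_add, eval_mul, eval_pow, eval_C, eval_X, eval_ofNat]; norm_num [b₂, b₄, b₆, b₈])
    (X2.CellACertN9.squarefree_of_nodup_primeFactorsList_natAbs (by norm_num) (by simp [Nat.primeFactorsList_ofNat])) (by norm_num)
    (by rw [KernelDisc.eval_Ψ₂Sq]; norm_num [b₂, b₄, b₆]) (by decide) (by decide) (by decide)

/-- `226512bv2` = `[0,0,0,-43264155,109524665162]` (class `226512bv`, (G-ord, `e = 2`) at `3`; twist `25168y2`, `a₃(V) = -1`, non-anomalous; even line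
`φ = χ_{11}`): `x₀ = 3993`, `D = 11`, `s = 12584`, `Ψ₂Sq(x₀) = 1741927616` ⇒ `X3LineDatumThree W`. [folklore] -/
theorem x3LineDatumThree_226512bv2 : X3LineDatumThree (⟨0, 0, 0, -43264155, 109524665162⟩ : WeierstrassCurve ℚ) :=
  x3LineDatumThree_of_cert_of_delta _ (by norm_num [Δ, b₂, b₄, b₆, b₈]) 3993 12584 11
    (by simp only [Ψ₃, eval_add, eval_mul, eval_pow, eval_C, eval_X, eval_ofNat]; norm_num [b₂, b₄, b₆, b₈])
    (X2.CellACertN9.squarefree_of_nodup_primeFactorsList_natAbs (by norm_num) (by simp [Nat.primeFactorsList_ofNat])) (by norm_num)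
    (by rw [KernelDisc.eval_Ψ₂Sq]; norm_num [b₂, b₄, b₆]) (by decide) (by decide) (by decide)

/-- `226512db2` = `[0,0,0,-78771,16959602]` (class `226512db`, (G-ord, `e = 2`) at `3`; twist `25168bb2`, `a₃(V) = -1`, non-anomalous; even line
`φ = χ_{11}`): `x₀ = 33`, `D = 11`, `s = 2288`, `Ψ₂Sq(x₀) = 57584384` ⇒ `X3LineDatumThree W`. [folklore] -/
theorem x3LineDatumThree_226512db2 : X3LineDatumThree (⟨0, 0, 0, -78771, 16959602⟩ : WeierstrassCurve ℚ) :=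
  x3LineDatumThree_of_cert_of_delta _ (by norm_num [Δ, b₂, b₄, b₆, b₈]) 33 2288 11
    (by simp only [Ψ₃, eval_add, eval_mul, eval_pow, eval_C, eval_X, eval_ofNat]; norm_num [b₂, b₄, b₆, b₈])
    (X2.CellACertN9.squarefree_of_nodup_primeFactorsList_natAbs (by norm_num) (by simp [Nat.primeFactorsList_ofNat])) (by norm_num)
    (by rw [KernelDisc.eval_Ψ₂Sq]; norm_num [b₂, b₄, b₆]) (by decide) (by decide) (by decide)

/-- `226512h2` = `[0,0,0,1018941,2604998594]` (class `226512h`, (G-ord, `e = 2`) at `3`; twist `25168bc2`, `a₃(V) = 2`, non-anomalous; even line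
`φ = χ_{11}`): `x₀ = 33`, `D = 11`, `s = 30976`, `Ψ₂Sq(x₀) = 10554638336` ⇒ `X3LineDatumThree W`. [folklore] -/
theorem x3LineDatumThree_226512h2 : X3LineDatumThree (⟨0, 0, 0, 1018941, 2604998594⟩ : WeierstrassCurve ℚ) :=
  x3LineDatumThree_of_cert_of_delta _ (by norm_num [Δ, b₂, b₄, b₆, b₈]) 33 30976 11
    (by simp only [Ψ₃, eval_add, eval_mul, eval_pow, eval_C, eval_X, eval_ofNat]; norm_num [b₂, b₄, b₆, b₈])
    (X2.CellACertN9.squarefree_of_nodup_primeFactorsList_natAbs (by norm_num) (by simp [Nat.primeFactorsList_ofNat])) (by norm_num)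
    (by rw [KernelDisc.eval_Ψ₂Sq]; norm_num [b₂, b₄, b₆]) (by decide) (by decide) (by decide)

/-- `226512i2` = `[0,0,0,-1817904,964714124]` (class `226512i`, (G-ord, `e = 2`) at `3`; twist `25168ba2`, `a₃(V) = -1`, non-anomalous; even line
`φ = χ_{11}`): `x₀ = 528`, `D = 11`, `s = 7436`, `Ψ₂Sq(x₀) = 608235056` ⇒ `X3LineDatumThree W`. [folklore] -/
theorem x3LineDatumThree_226512i2 : X3LineDatumThree (⟨0, 0, 0, -1817904, 964714124⟩ : WeierstrassCurve ℚ) :=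
  x3LineDatumThree_of_cert_of_delta _ (by norm_num [Δ, b₂, b₄, b₆, b₈]) 528 7436 11
    (by simp only [Ψ₃, eval_add, eval_mul, eval_pow, eval_C, eval_X, eval_ofNat]; norm_num [b₂, b₄, b₆, b₈])
    (X2.CellACertN9.squarefree_of_nodup_primeFactorsList_natAbs (by norm_num) (by simp [Nat.primeFactorsList_ofNat])) (by norm_num)
    (by rw [KernelDisc.eval_Ψ₂Sq]; norm_num [b₂, b₄, b₆]) (by decide) (by decide) (by decide)

/-- `228672by2` = `[0,0,0,7476,-7436176]` (class `228672by`, (G-ord, `e = 2`) at `3`; twist `25408b2`, `a₃(V) = -1`, non-anomalous; even line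
`φ = χ_{2}`): `x₀ = 294`, `D = 2`, `s = 6352`, `Ψ₂Sq(x₀) = 80695808` ⇒ `X3LineDatumThree W`. [folklore] -/
theorem x3LineDatumThree_228672by2 : X3LineDatumThree (⟨0, 0, 0, 7476, -7436176⟩ : WeierstrassCurve ℚ) :=
  x3LineDatumThree_of_cert_of_delta _ (by norm_num [Δ, b₂, b₄, b₆, b₈]) 294 6352 2
    (by simp only [Ψ₃, eval_add, eval_mul, eval_pow, eval_C, eval_X, eval_ofNat]; norm_num [b₂, b₄, b₆, b₈])
    Int.prime_two.squarefree (by norm_num)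
    (by rw [KernelDisc.eval_Ψ₂Sq]; norm_num [b₂, b₄, b₆]) (by decide) (by decide) (by decide)

/-- `228672cn2` = `[0,0,0,-2000460,1089850736]` (class `228672cn`, (G-ord, `e = 2`) at `3`; twist `25408d2`, `a₃(V) = 2`, non-anomalous; even line
`φ = χ_{2}`): `x₀ = 726`, `D = 2`, `s = 6352`, `Ψ₂Sq(x₀) = 80695808` ⇒ `X3LineDatumThree W`. [folklore] -/
theorem x3LineDatumThree_228672cn2 : X3LineDatumThree (⟨0, 0, 0, -2000460, 1089850736⟩ : WeierstrassCurve ℚ) :=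
  x3LineDatumThree_of_cert_of_delta _ (by norm_num [Δ, b₂, b₄, b₆, b₈]) 726 6352 2
    (by simp only [Ψ₃, eval_add, eval_mul, eval_pow, eval_C, eval_X, eval_ofNat]; norm_num [b₂, b₄, b₆, b₈])
    Int.prime_two.squarefree (by norm_num)
    (by rw [KernelDisc.eval_Ψ₂Sq]; norm_num [b₂, b₄, b₆]) (by decide) (by decide) (by decide)

/-- `229950fc2` = `[1,-1,0,-1460817,700349341]` (class `229950fc`, (G-ord, `e = 2`) at `3`; twist `25550p2`, `a₃(V) = -1`, non-anomalous; even line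
`φ = χ_{5}`): `x₀ = 454`, `D = 5`, `s = 10220`, `Ψ₂Sq(x₀) = 522242000` ⇒ `X3LineDatumThree W`. [folklore] -/
theorem x3LineDatumThree_229950fc2 : X3LineDatumThree (⟨1, -1, 0, -1460817, 700349341⟩ : WeierstrassCurve ℚ) :=
  x3LineDatumThree_of_cert_of_delta _ (by norm_num [Δ, b₂, b₄, b₆, b₈]) 454 10220 5
    (by simp only [Ψ₃, eval_add, eval_mul, eval_pow, eval_C, eval_X, eval_ofNat]; norm_num [b₂, b₄, b₆, b₈])
    (X2.CellACertN9.squarefree_of_nodup_primeFactorsList_natAbs (by norm_num) (by simp [Nat.primeFactorsList_ofNat])) (by norm_num)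
    (by rw [KernelDisc.eval_Ψ₂Sq]; norm_num [b₂, b₄, b₆]) (by decide) (by decide) (by decide)

/-- `232650cr2` = `[1,-1,1,-6980,166227]` (class `232650cr`, (G-ord, `e = 2`) at `3`; twist `25850a2`, `a₃(V) = -1`, non-anomalous; even line
`φ = χ_{5}`): `x₀ = 94`, `D = 5`, `s = 517`, `Ψ₂Sq(x₀) = 1336445` ⇒ `X3LineDatumThree W`. [folklore] -/
theorem x3LineDatumThree_232650cr2 : X3LineDatumThree (⟨1, -1, 1, -6980, 166227⟩ : WeierstrassCurve ℚ) :=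
  x3LineDatumThree_of_cert_of_delta _ (by norm_num [Δ, b₂, b₄, b₆, b₈]) 94 517 5
    (by simp only [Ψ₃, eval_add, eval_mul, eval_pow, eval_C, eval_X, eval_ofNat]; norm_num [b₂, b₄, b₆, b₈])
    (X2.CellACertN9.squarefree_of_nodup_primeFactorsList_natAbs (by norm_num) (by simp [Nat.primeFactorsList_ofNat])) (by norm_num)
    (by rw [KernelDisc.eval_Ψ₂Sq]; norm_num [b₂, b₄, b₆]) (by decide) (by decide) (by decide)

/-- `234099f2` = `[0,0,1,-114996,15968358]` (class `234099f`, (G-ord, `e = 2`) at `3`; twist `26011a2`, `a₃(V) = -2` — ANOMALOUS (outside the end state as typed); even line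
`φ = χ_{37}`): `x₀ = 111`, `D = 37`, `s = 703`, `Ψ₂Sq(x₀) = 18285733` ⇒ `X3LineDatumThree W`. [folklore] -/
theorem x3LineDatumThree_234099f2 : X3LineDatumThree (⟨0, 0, 1, -114996, 15968358⟩ : WeierstrassCurve ℚ) :=
  x3LineDatumThree_of_cert_of_delta _ (by norm_num [Δ, b₂, b₄, b₆, b₈]) 111 703 37
    (by simp only [Ψ₃, eval_add, eval_mul, eval_pow, eval_C, eval_X, eval_ofNat]; norm_num [b₂, b₄, b₆, b₈])
    (X2.CellACertN9.squarefree_of_nodup_primeFactorsList_natAbs (by norm_num) (by simp [Nat.primeFactorsList_ofNat])) (by norm_num)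
    (by rw [KernelDisc.eval_Ψ₂Sq]; norm_num [b₂, b₄, b₆]) (by decide) (by decide) (by decide)

/-- `234234z2` = `[1,-1,0,-3717,136917]` (class `234234z`, (G-ord, `e = 2`) at `3`; twist `26026l2`, `a₃(V) = 1` — ANOMALOUS (outside the end state as typed); even line
`φ = χ_{13}`): `x₀ = 10`, `D = 13`, `s = 176`, `Ψ₂Sq(x₀) = 402688` ⇒ `X3LineDatumThree W`. [folklore] -/
theorem x3LineDatumThree_234234z2 : X3LineDatumThree (⟨1, -1, 0, -3717, 136917⟩ : WeierstrassCurve ℚ) :=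
  x3LineDatumThree_of_cert_of_delta _ (by norm_num [Δ, b₂, b₄, b₆, b₈]) 10 176 13
    (by simp only [Ψ₃, eval_add, eval_mul, eval_pow, eval_C, eval_X, eval_ofNat]; norm_num [b₂, b₄, b₆, b₈])
    (X2.CellACertN9.squarefree_of_nodup_primeFactorsList_natAbs (by norm_num) (by simp [Nat.primeFactorsList_ofNat])) (by norm_num)
    (by rw [KernelDisc.eval_Ψ₂Sq]; norm_num [b₂, b₄, b₆]) (by decide) (by decide) (by decide)

/-- `235755bf2` = `[0,0,1,-1827228,955234179]` (class `235755bf`, (G-ord, `e = 2`) at `3`; twist `26195h2`, `a₃(V) = -2` — ANOMALOUS (outside the end state as typed); even line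
`φ = χ_{13}`): `x₀ = 624`, `D = 13`, `s = 4225`, `Ψ₂Sq(x₀) = 232058125` ⇒ `X3LineDatumThree W`. [folklore] -/
theorem x3LineDatumThree_235755bf2 : X3LineDatumThree (⟨0, 0, 1, -1827228, 955234179⟩ : WeierstrassCurve ℚ) :=
  x3LineDatumThree_of_cert_of_delta _ (by norm_num [Δ, b₂, b₄, b₆, b₈]) 624 4225 13
    (by simp only [Ψ₃, eval_add, eval_mul, eval_pow, eval_C, eval_X, eval_ofNat]; norm_num [b₂, b₄, b₆, b₈])
    (X2.CellACertN9.squarefree_of_nodup_primeFactorsList_natAbs (by norm_num) (by simp [Nat.primeFactorsList_ofNat])) (by norm_num)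
    (by rw [KernelDisc.eval_Ψ₂Sq]; norm_num [b₂, b₄, b₆]) (by decide) (by decide) (by decide)

/-- `235755y2` = `[0,0,1,-73398,7653753]` (class `235755y`, (G-ord, `e = 2`) at `3`; twist `26195g2`, `a₃(V) = 1` — ANOMALOUS (outside the end state as typed); even line
`φ = χ_{13}`): `x₀ = 156`, `D = 13`, `s = 5`, `Ψ₂Sq(x₀) = 325` ⇒ `X3LineDatumThree W`. [folklore] -/
theorem x3LineDatumThree_235755y2 : X3LineDatumThree (⟨0, 0, 1, -73398, 7653753⟩ : WeierstrassCurve ℚ) :=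
  x3LineDatumThree_of_cert_of_delta _ (by norm_num [Δ, b₂, b₄, b₆, b₈]) 156 5 13
    (by simp only [Ψ₃, eval_add, eval_mul, eval_pow, eval_C, eval_X, eval_ofNat]; norm_num [b₂, b₄, b₆, b₈])
    (X2.CellACertN9.squarefree_of_nodup_primeFactorsList_natAbs (by norm_num) (by simp [Nat.primeFactorsList_ofNat])) (by norm_num)
    (by rw [KernelDisc.eval_Ψ₂Sq]; norm_num [b₂, b₄, b₆]) (by decide) (by decide) (by decide)

/-- `235755z2` = `[0,0,1,423852,375588684]` (class `235755z`, (G-ord, `e = 2`) at `3`; twist `26195f2`, `a₃(V) = 1` — ANOMALOUS (outside the end state as typed); even line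
`φ = χ_{13}`): `x₀ = 39`, `D = 13`, `s = 10985`, `Ψ₂Sq(x₀) = 1568712925` ⇒ `X3LineDatumThree W`. [folklore] -/
theorem x3LineDatumThree_235755z2 : X3LineDatumThree (⟨0, 0, 1, 423852, 375588684⟩ : WeierstrassCurve ℚ) :=
  x3LineDatumThree_of_cert_of_delta _ (by norm_num [Δ, b₂, b₄, b₆, b₈]) 39 10985 13
    (by simp only [Ψ₃, eval_add, eval_mul, eval_pow, eval_C, eval_X, eval_ofNat]; norm_num [b₂, b₄, b₆, b₈])
    (X2.CellACertN9.squarefree_of_nodup_primeFactorsList_natAbs (by norm_num) (by simp [Nat.primeFactorsList_ofNat])) (by norm_num)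
    (by rw [KernelDisc.eval_Ψ₂Sq]; norm_num [b₂, b₄, b₆]) (by decide) (by decide) (by decide)

/-- `239040l2` = `[0,0,0,-43968,-5294392]` (class `239040l`, (G-ord, `e = 2`) at `3`; twist `26560i2`, `a₃(V) = -1`, non-anomalous; even line
`φ = χ_{2}`): `x₀ = 384`, `D = 2`, `s = 8300`, `Ψ₂Sq(x₀) = 137780000` ⇒ `X3LineDatumThree W`. [folklore] -/
theorem x3LineDatumThree_239040l2 : X3LineDatumThree (⟨0, 0, 0, -43968, -5294392⟩ : WeierstrassCurve ℚ) :=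
  x3LineDatumThree_of_cert_of_delta _ (by norm_num [Δ, b₂, b₄, b₆, b₈]) 384 8300 2
    (by simp only [Ψ₃, eval_add, eval_mul, eval_pow, eval_C, eval_X, eval_ofNat]; norm_num [b₂, b₄, b₆, b₈])
    Int.prime_two.squarefree (by norm_num)
    (by rw [KernelDisc.eval_Ψ₂Sq]; norm_num [b₂, b₄, b₆]) (by decide) (by decide) (by decide)

/-- `240075v2` = `[0,0,1,-603750,181022656]` (class `240075v`, (G-ord, `e = 2`) at `3`; twist `26675f2`, `a₃(V) = -1`, non-anomalous; even line
`φ = χ_{5}`): `x₀ = 375`, `D = 5`, `s = 2425`, `Ψ₂Sq(x₀) = 29403125` ⇒ `X3LineDatumThree W`. [folklore] -/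
theorem x3LineDatumThree_240075v2 : X3LineDatumThree (⟨0, 0, 1, -603750, 181022656⟩ : WeierstrassCurve ℚ) :=
  x3LineDatumThree_of_cert_of_delta _ (by norm_num [Δ, b₂, b₄, b₆, b₈]) 375 2425 5
    (by simp only [Ψ₃, eval_add, eval_mul, eval_pow, eval_C, eval_X, eval_ofNat]; norm_num [b₂, b₄, b₆, b₈])
    (X2.CellACertN9.squarefree_of_nodup_primeFactorsList_natAbs (by norm_num) (by simp [Nat.primeFactorsList_ofNat])) (by norm_num)
    (by rw [KernelDisc.eval_Ψ₂Sq]; norm_num [b₂, b₄, b₆]) (by decide) (by decide) (by decide)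

/-- `242100l2` = `[0,0,0,-208425,-17744875]` (class `242100l`, (G-ord, `e = 2`) at `3`; twist `26900a2`, `a₃(V) = -1`, non-anomalous; even line
`φ = χ_{5}`): `x₀ = 735`, `D = 5`, `s = 13450`, `Ψ₂Sq(x₀) = 904512500` ⇒ `X3LineDatumThree W`. [folklore] -/
theorem x3LineDatumThree_242100l2 : X3LineDatumThree (⟨0, 0, 0, -208425, -17744875⟩ : WeierstrassCurve ℚ) :=
  x3LineDatumThree_of_cert_of_delta _ (by norm_num [Δ, b₂, b₄, b₆, b₈]) 735 13450 5
    (by simp only [Ψ₃, eval_add, eval_mul, eval_pow, eval_C, eval_X, eval_ofNat]; norm_num [b₂, b₄, b₆, b₈])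
    (X2.CellACertN9.squarefree_of_nodup_primeFactorsList_natAbs (by norm_num) (by simp [Nat.primeFactorsList_ofNat])) (by norm_num)
    (by rw [KernelDisc.eval_Ψ₂Sq]; norm_num [b₂, b₄, b₆]) (by decide) (by decide) (by decide)

/-- `242550bd2` = `[1,-1,0,30004308,405514795216]` (class `242550bd`, (G-ord, `e = 2`) at `3`; twist `26950bx2`, `a₃(V) = -1`, non-anomalous; even line
`φ = χ_{5}`): `x₀ = 184`, `D = 5`, `s = 573440`, `Ψ₂Sq(x₀) = 1644167168000` ⇒ `X3LineDatumThree W`. [folklore] -/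
theorem x3LineDatumThree_242550bd2 : X3LineDatumThree (⟨1, -1, 0, 30004308, 405514795216⟩ : WeierstrassCurve ℚ) :=
  x3LineDatumThree_of_cert_of_delta _ (by norm_num [Δ, b₂, b₄, b₆, b₈]) 184 573440 5
    (by simp only [Ψ₃, eval_add, eval_mul, eval_pow, eval_C, eval_X, eval_ofNat]; norm_num [b₂, b₄, b₆, b₈])
    (X2.CellACertN9.squarefree_of_nodup_primeFactorsList_natAbs (by norm_num) (by simp [Nat.primeFactorsList_ofNat])) (by norm_num)
    (by rw [KernelDisc.eval_Ψ₂Sq]; norm_num [b₂, b₄, b₆]) (by decide) (by decide) (by decide)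

/-- `242550h2` = `[1,-1,0,-2062584792,24003768951616]` (class `242550h`, (G-ord, `e = 2`) at `3`; twist `26950bz2`, `a₃(V) = -1`, non-anomalous; even line
`φ = χ_{5}`): `x₀ = 53104`, `D = 5`, `s = 7168000`, `Ψ₂Sq(x₀) = 256901120000000` ⇒ `X3LineDatumThree W`. [folklore] -/
theorem x3LineDatumThree_242550h2 : X3LineDatumThree (⟨1, -1, 0, -2062584792, 24003768951616⟩ : WeierstrassCurve ℚ) :=
  x3LineDatumThree_of_cert_of_delta _ (by norm_num [Δ, b₂, b₄, b₆, b₈]) 53104 7168000 5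
    (by simp only [Ψ₃, eval_add, eval_mul, eval_pow, eval_C, eval_X, eval_ofNat]; norm_num [b₂, b₄, b₆, b₈])
    (X2.CellACertN9.squarefree_of_nodup_primeFactorsList_natAbs (by norm_num) (by simp [Nat.primeFactorsList_ofNat])) (by norm_num)
    (by rw [KernelDisc.eval_Ψ₂Sq]; norm_num [b₂, b₄, b₆]) (by decide) (by decide) (by decide)

/-- `242550lw2` = `[1,-1,1,-62600180,190654515447]` (class `242550lw`, (G-ord, `e = 2`) at `3`; twist `26950c2`, `a₃(V) = -1`, non-anomalous; even line
`φ = χ_{5}`): `x₀ = 4594`, `D = 5`, `s = 2695`, `Ψ₂Sq(x₀) = 36315125` ⇒ `X3LineDatumThree W`. [folklore] -/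
theorem x3LineDatumThree_242550lw2 : X3LineDatumThree (⟨1, -1, 1, -62600180, 190654515447⟩ : WeierstrassCurve ℚ) :=
  x3LineDatumThree_of_cert_of_delta _ (by norm_num [Δ, b₂, b₄, b₆, b₈]) 4594 2695 5
    (by simp only [Ψ₃, eval_add, eval_mul, eval_pow, eval_C, eval_X, eval_ofNat]; norm_num [b₂, b₄, b₆, b₈])
    (X2.CellACertN9.squarefree_of_nodup_primeFactorsList_natAbs (by norm_num) (by simp [Nat.primeFactorsList_ofNat])) (by norm_num)
    (by rw [KernelDisc.eval_Ψ₂Sq]; norm_num [b₂, b₄, b₆]) (by decide) (by decide) (by decide)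

/-- `242550of2` = `[1,-1,1,-24398555,42610484697]` (class `242550of`, (G-ord, `e = 2`) at `3`; twist `26950d2`, `a₃(V) = 2`, non-anomalous; even line
`φ = χ_{5}`): `x₀ = 4594`, `D = 5`, `s = 148225`, `Ψ₂Sq(x₀) = 109853253125` ⇒ `X3LineDatumThree W`. [folklore] -/
theorem x3LineDatumThree_242550of2 : X3LineDatumThree (⟨1, -1, 1, -24398555, 42610484697⟩ : WeierstrassCurve ℚ) :=
  x3LineDatumThree_of_cert_of_delta _ (by norm_num [Δ, b₂, b₄, b₆, b₈]) 4594 148225 5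
    (by simp only [Ψ₃, eval_add, eval_mul, eval_pow, eval_C, eval_X, eval_ofNat]; norm_num [b₂, b₄, b₆, b₈])
    (X2.CellACertN9.squarefree_of_nodup_primeFactorsList_natAbs (by norm_num) (by simp [Nat.primeFactorsList_ofNat])) (by norm_num)
    (by rw [KernelDisc.eval_Ψ₂Sq]; norm_num [b₂, b₄, b₆]) (by decide) (by decide) (by decide)

/-- `242775s2` = `[0,0,1,51450,2079031]` (class `242775s`, (G-ord, `e = 2`) at `3`; twist `26975a2`, `a₃(V) = 2`, non-anomalous; even line
`φ = χ_{5}`): `x₀ = 60`, `D = 5`, `s = 2075`, `Ψ₂Sq(x₀) = 21528125` ⇒ `X3LineDatumThree W`. [folklore] -/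
theorem x3LineDatumThree_242775s2 : X3LineDatumThree (⟨0, 0, 1, 51450, 2079031⟩ : WeierstrassCurve ℚ) :=
  x3LineDatumThree_of_cert_of_delta _ (by norm_num [Δ, b₂, b₄, b₆, b₈]) 60 2075 5
    (by simp only [Ψ₃, eval_add, eval_mul, eval_pow, eval_C, eval_X, eval_ofNat]; norm_num [b₂, b₄, b₆, b₈])
    (X2.CellACertN9.squarefree_of_nodup_primeFactorsList_natAbs (by norm_num) (by simp [Nat.primeFactorsList_ofNat])) (by norm_num)
    (by rw [KernelDisc.eval_Ψ₂Sq]; norm_num [b₂, b₄, b₆]) (by decide) (by decide) (by decide)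

/-- `243450bw2` = `[1,-1,1,20245,9065247]` (class `243450bw`, (G-ord, `e = 2`) at `3`; twist `27050b2`, `a₃(V) = -1`, non-anomalous; even line
`φ = χ_{5}`): `x₀ = 4`, `D = 5`, `s = 2705`, `Ψ₂Sq(x₀) = 36585125` ⇒ `X3LineDatumThree W`. [folklore] -/
theorem x3LineDatumThree_243450bw2 : X3LineDatumThree (⟨1, -1, 1, 20245, 9065247⟩ : WeierstrassCurve ℚ) :=
  x3LineDatumThree_of_cert_of_delta _ (by norm_num [Δ, b₂, b₄, b₆, b₈]) 4 2705 5
    (by simp only [Ψ₃, eval_add, eval_mul, eval_pow, eval_C, eval_X, eval_ofNat]; norm_num [b₂, b₄, b₆, b₈])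
    (X2.CellACertN9.squarefree_of_nodup_primeFactorsList_natAbs (by norm_num) (by simp [Nat.primeFactorsList_ofNat])) (by norm_num)
    (by rw [KernelDisc.eval_Ψ₂Sq]; norm_num [b₂, b₄, b₆]) (by decide) (by decide) (by decide)

/-- `244800ey2` = `[0,0,0,-95630700,371557294000]` (class `244800ey`, (G-ord, `e = 2`) at `3`; twist `27200u2`, `a₃(V) = 1` — ANOMALOUS (outside the end state as typed); even line
`φ = χ_{10}`): `x₀ = 3630`, `D = 10`, `s = 170000`, `Ψ₂Sq(x₀) = 289000000000` ⇒ `X3LineDatumThree W`. [folklore] -/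
theorem x3LineDatumThree_244800ey2 : X3LineDatumThree (⟨0, 0, 0, -95630700, 371557294000⟩ : WeierstrassCurve ℚ) :=
  x3LineDatumThree_of_cert_of_delta _ (by norm_num [Δ, b₂, b₄, b₆, b₈]) 3630 170000 10
    (by simp only [Ψ₃, eval_add, eval_mul, eval_pow, eval_C, eval_X, eval_ofNat]; norm_num [b₂, b₄, b₆, b₈])
    (X2.CellACertN9.squarefree_of_nodup_primeFactorsList_natAbs (by norm_num) (by simp [Nat.primeFactorsList_ofNat])) (by norm_num)
    (by rw [KernelDisc.eval_Ψ₂Sq]; norm_num [b₂, b₄, b₆]) (by decide) (by decide) (by decide)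

/-- `244800fi2` = `[0,0,0,323700,286198000]` (class `244800fi`, (G-ord, `e = 2`) at `3`; twist `27200v2`, `a₃(V) = 1` — ANOMALOUS (outside the end state as typed); even line
`φ = χ_{10}`): `x₀ = 30`, `D = 10`, `s = 10880`, `Ψ₂Sq(x₀) = 1183744000` ⇒ `X3LineDatumThree W`. [folklore] -/
theorem x3LineDatumThree_244800fi2 : X3LineDatumThree (⟨0, 0, 0, 323700, 286198000⟩ : WeierstrassCurve ℚ) :=
  x3LineDatumThree_of_cert_of_delta _ (by norm_num [Δ, b₂, b₄, b₆, b₈]) 30 10880 10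
    (by simp only [Ψ₃, eval_add, eval_mul, eval_pow, eval_C, eval_X, eval_ofNat]; norm_num [b₂, b₄, b₆, b₈])
    (X2.CellACertN9.squarefree_of_nodup_primeFactorsList_natAbs (by norm_num) (by simp [Nat.primeFactorsList_ofNat])) (by norm_num)
    (by rw [KernelDisc.eval_Ψ₂Sq]; norm_num [b₂, b₄, b₆]) (by decide) (by decide) (by decide)

/-- `244800hf2` = `[0,0,0,-169500,27830000]` (class `244800hf`, (G-ord, `e = 2`) at `3`; twist `27200bf2`, `a₃(V) = -1`, non-anomalous; even line
`φ = χ_{2}`): `x₀ = 150`, `D = 2`, `s = 3400`, `Ψ₂Sq(x₀) = 23120000` ⇒ `X3LineDatumThree W`. [folklore] -/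
theorem x3LineDatumThree_244800hf2 : X3LineDatumThree (⟨0, 0, 0, -169500, 27830000⟩ : WeierstrassCurve ℚ) :=
  x3LineDatumThree_of_cert_of_delta _ (by norm_num [Δ, b₂, b₄, b₆, b₈]) 150 3400 2
    (by simp only [Ψ₃, eval_add, eval_mul, eval_pow, eval_C, eval_X, eval_ofNat]; norm_num [b₂, b₄, b₆, b₈])
    Int.prime_two.squarefree (by norm_num)
    (by rw [KernelDisc.eval_Ψ₂Sq]; norm_num [b₂, b₄, b₆]) (by decide) (by decide) (by decide)

/-- `244800mc2` = `[0,0,0,-6780,222640]` (class `244800mc`, (G-ord, `e = 2`) at `3`; twist `27200t2`, `a₃(V) = 1` — ANOMALOUS (outside the end state as typed); even line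
`φ = χ_{10}`): `x₀ = 30`, `D = 10`, `s = 136`, `Ψ₂Sq(x₀) = 184960` ⇒ `X3LineDatumThree W`. [folklore] -/
theorem x3LineDatumThree_244800mc2 : X3LineDatumThree (⟨0, 0, 0, -6780, 222640⟩ : WeierstrassCurve ℚ) :=
  x3LineDatumThree_of_cert_of_delta _ (by norm_num [Δ, b₂, b₄, b₆, b₈]) 30 136 10
    (by simp only [Ψ₃, eval_add, eval_mul, eval_pow, eval_C, eval_X, eval_ofNat]; norm_num [b₂, b₄, b₆, b₈])
    (X2.CellACertN9.squarefree_of_nodup_primeFactorsList_natAbs (by norm_num) (by simp [Nat.primeFactorsList_ofNat])) (by norm_num)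
    (by rw [KernelDisc.eval_Ψ₂Sq]; norm_num [b₂, b₄, b₆]) (by decide) (by decide) (by decide)

/-- `244800st3` = `[0,0,0,-1483500,695374000]` (class `244800st`, (G-ord, `e = 2`) at `3`; twist `27200z3`, `a₃(V) = -2` — ANOMALOUS (outside the end state as typed); even line
`φ = χ_{10}`): `x₀ = 750`, `D = 10`, `s = 1360`, `Ψ₂Sq(x₀) = 18496000` ⇒ `X3LineDatumThree W`. [folklore] -/
theorem x3LineDatumThree_244800st3 : X3LineDatumThree (⟨0, 0, 0, -1483500, 695374000⟩ : WeierstrassCurve ℚ) :=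
  x3LineDatumThree_of_cert_of_delta _ (by norm_num [Δ, b₂, b₄, b₆, b₈]) 750 1360 10
    (by simp only [Ψ₃, eval_add, eval_mul, eval_pow, eval_C, eval_X, eval_ofNat]; norm_num [b₂, b₄, b₆, b₈])
    (X2.CellACertN9.squarefree_of_nodup_primeFactorsList_natAbs (by norm_num) (by simp [Nat.primeFactorsList_ofNat])) (by norm_num)
    (by rw [KernelDisc.eval_Ψ₂Sq]; norm_num [b₂, b₄, b₆]) (by decide) (by decide) (by decide)

/-- `247950ef2` = `[1,-1,1,-12117155,16237927347]` (class `247950ef`, (G-ord, `e = 2`) at `3`; twist `27550i2`, `a₃(V) = -1`, non-anomalous; even line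
`φ = χ_{5}`): `x₀ = 1984`, `D = 5`, `s = 1805`, `Ψ₂Sq(x₀) = 16290125` ⇒ `X3LineDatumThree W`. [folklore] -/
theorem x3LineDatumThree_247950ef2 : X3LineDatumThree (⟨1, -1, 1, -12117155, 16237927347⟩ : WeierstrassCurve ℚ) :=
  x3LineDatumThree_of_cert_of_delta _ (by norm_num [Δ, b₂, b₄, b₆, b₈]) 1984 1805 5
    (by simp only [Ψ₃, eval_add, eval_mul, eval_pow, eval_C, eval_X, eval_ofNat]; norm_num [b₂, b₄, b₆, b₈])
    (X2.CellACertN9.squarefree_of_nodup_primeFactorsList_natAbs (by norm_num) (by simp [Nat.primeFactorsList_ofNat])) (by norm_num)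
    (by rw [KernelDisc.eval_Ψ₂Sq]; norm_num [b₂, b₄, b₆]) (by decide) (by decide) (by decide)

/-- `251712eu2` = `[0,0,0,-369152076,2729958758768]` (class `251712eu`, (G-ord, `e = 2`) at `3`; twist `27968f2`, `a₃(V) = -1`, non-anomalous; even line
`φ = χ_{2}`): `x₀ = 11094`, `D = 2`, `s = 304`, `Ψ₂Sq(x₀) = 184832` ⇒ `X3LineDatumThree W`. [folklore] -/
theorem x3LineDatumThree_251712eu2 : X3LineDatumThree (⟨0, 0, 0, -369152076, 2729958758768⟩ : WeierstrassCurve ℚ) :=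
  x3LineDatumThree_of_cert_of_delta _ (by norm_num [Δ, b₂, b₄, b₆, b₈]) 11094 304 2
    (by simp only [Ψ₃, eval_add, eval_mul, eval_pow, eval_C, eval_X, eval_ofNat]; norm_num [b₂, b₄, b₆, b₈])
    Int.prime_two.squarefree (by norm_num)
    (by rw [KernelDisc.eval_Ψ₂Sq]; norm_num [b₂, b₄, b₆]) (by decide) (by decide) (by decide)

/-- `252810k2` = `[1,-1,0,1620,-42800]` (class `252810k`, (G-ord, `e = 2`) at `3`; twist `28090g2`, `a₃(V) = -1`, non-anomalous; even line
`φ = χ_{53}`): `x₀ = 40`, `D = 53`, `s = 80`, `Ψ₂Sq(x₀) = 339200` ⇒ `X3LineDatumThree W`. [folklore] -/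
theorem x3LineDatumThree_252810k2 : X3LineDatumThree (⟨1, -1, 0, 1620, -42800⟩ : WeierstrassCurve ℚ) :=
  x3LineDatumThree_of_cert_of_delta _ (by norm_num [Δ, b₂, b₄, b₆, b₈]) 40 80 53
    (by simp only [Ψ₃, eval_add, eval_mul, eval_pow, eval_C, eval_X, eval_ofNat]; norm_num [b₂, b₄, b₆, b₈])
    (X2.CellACertN9.squarefree_of_nodup_primeFactorsList_natAbs (by norm_num) (by simp [Nat.primeFactorsList_ofNat])) (by norm_num)
    (by rw [KernelDisc.eval_Ψ₂Sq]; norm_num [b₂, b₄, b₆]) (by decide) (by decide) (by decide)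

/-- `252810r2` = `[1,-1,0,-74035935,245217750925]` (class `252810r`, (G-ord, `e = 2`) at `3`; twist `28090h2`, `a₃(V) = -1`, non-anomalous; even line
`φ = χ_{53}`): `x₀ = 4810`, `D = 53`, `s = 5300`, `Ψ₂Sq(x₀) = 1488770000` ⇒ `X3LineDatumThree W`. [folklore] -/
theorem x3LineDatumThree_252810r2 : X3LineDatumThree (⟨1, -1, 0, -74035935, 245217750925⟩ : WeierstrassCurve ℚ) :=
  x3LineDatumThree_of_cert_of_delta _ (by norm_num [Δ, b₂, b₄, b₆, b₈]) 4810 5300 53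
    (by simp only [Ψ₃, eval_add, eval_mul, eval_pow, eval_C, eval_X, eval_ofNat]; norm_num [b₂, b₄, b₆, b₈])
    (X2.CellACertN9.squarefree_of_nodup_primeFactorsList_natAbs (by norm_num) (by simp [Nat.primeFactorsList_ofNat])) (by norm_num)
    (by rw [KernelDisc.eval_Ψ₂Sq]; norm_num [b₂, b₄, b₆]) (by decide) (by decide) (by decide)

/-- `252900bh2` = `[0,0,0,-34483800,-76042199500]` (class `252900bh`, (G-ord, `e = 2`) at `3`; twist `28100b2`, `a₃(V) = -1`, non-anomalous; even line
`φ = χ_{5}`): `x₀ = 10140`, `D = 5`, `s = 702500`, `Ψ₂Sq(x₀) = 2467531250000` ⇒ `X3LineDatumThree W`. [folklore] -/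
theorem x3LineDatumThree_252900bh2 : X3LineDatumThree (⟨0, 0, 0, -34483800, -76042199500⟩ : WeierstrassCurve ℚ) :=
  x3LineDatumThree_of_cert_of_delta _ (by norm_num [Δ, b₂, b₄, b₆, b₈]) 10140 702500 5
    (by simp only [Ψ₃, eval_add, eval_mul, eval_pow, eval_C, eval_X, eval_ofNat]; norm_num [b₂, b₄, b₆, b₈])
    (X2.CellACertN9.squarefree_of_nodup_primeFactorsList_natAbs (by norm_num) (by simp [Nat.primeFactorsList_ofNat])) (by norm_num)
    (by rw [KernelDisc.eval_Ψ₂Sq]; norm_num [b₂, b₄, b₆]) (by decide) (by decide) (by decide)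

/-- `256950cc2` = `[1,-1,1,-4955,49317]` (class `256950cc`, (G-ord, `e = 2`) at `3`; twist `28550e2`, `a₃(V) = 2`, non-anomalous; even line
`φ = χ_{5}`): `x₀ = 94`, `D = 5`, `s = 571`, `Ψ₂Sq(x₀) = 1630205` ⇒ `X3LineDatumThree W`. [folklore] -/
theorem x3LineDatumThree_256950cc2 : X3LineDatumThree (⟨1, -1, 1, -4955, 49317⟩ : WeierstrassCurve ℚ) :=
  x3LineDatumThree_of_cert_of_delta _ (by norm_num [Δ, b₂, b₄, b₆, b₈]) 94 571 5
    (by simp only [Ψ₃, eval_add, eval_mul, eval_pow, eval_C, eval_X, eval_ofNat]; norm_num [b₂, b₄, b₆, b₈])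
    (X2.CellACertN9.squarefree_of_nodup_primeFactorsList_natAbs (by norm_num) (by simp [Nat.primeFactorsList_ofNat])) (by norm_num)
    (by rw [KernelDisc.eval_Ψ₂Sq]; norm_num [b₂, b₄, b₆]) (by decide) (by decide) (by decide)

/-- `258300m2` = `[0,0,0,112200,14064500]` (class `258300m`, (G-ord, `e = 2`) at `3`; twist `28700b2`, `a₃(V) = 2`, non-anomalous; even line
`φ = χ_{5}`): `x₀ = 60`, `D = 5`, `s = 4100`, `Ψ₂Sq(x₀) = 84050000` ⇒ `X3LineDatumThree W`. [folklore] -/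
theorem x3LineDatumThree_258300m2 : X3LineDatumThree (⟨0, 0, 0, 112200, 14064500⟩ : WeierstrassCurve ℚ) :=
  x3LineDatumThree_of_cert_of_delta _ (by norm_num [Δ, b₂, b₄, b₆, b₈]) 60 4100 5
    (by simp only [Ψ₃, eval_add, eval_mul, eval_pow, eval_C, eval_X, eval_ofNat]; norm_num [b₂, b₄, b₆, b₈])
    (X2.CellACertN9.squarefree_of_nodup_primeFactorsList_natAbs (by norm_num) (by simp [Nat.primeFactorsList_ofNat])) (by norm_num)
    (by rw [KernelDisc.eval_Ψ₂Sq]; norm_num [b₂, b₄, b₆]) (by decide) (by decide) (by decide)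

/-- `258570a2` = `[1,-1,0,-138735,9271341]` (class `258570a`, (G-ord, `e = 2`) at `3`; twist `28730bd2`, `a₃(V) = -2` — ANOMALOUS (outside the end state as typed); even line
`φ = χ_{13}`): `x₀ = 478`, `D = 13`, `s = 4000`, `Ψ₂Sq(x₀) = 208000000` ⇒ `X3LineDatumThree W`. [folklore] -/
theorem x3LineDatumThree_258570a2 : X3LineDatumThree (⟨1, -1, 0, -138735, 9271341⟩ : WeierstrassCurve ℚ) :=
  x3LineDatumThree_of_cert_of_delta _ (by norm_num [Δ, b₂, b₄, b₆, b₈]) 478 4000 13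
    (by simp only [Ψ₃, eval_add, eval_mul, eval_pow, eval_C, eval_X, eval_ofNat]; norm_num [b₂, b₄, b₆, b₈])
    (X2.CellACertN9.squarefree_of_nodup_primeFactorsList_natAbs (by norm_num) (by simp [Nat.primeFactorsList_ofNat])) (by norm_num)
    (by rw [KernelDisc.eval_Ψ₂Sq]; norm_num [b₂, b₄, b₆]) (by decide) (by decide) (by decide)

/-- `258570bw2` = `[1,-1,0,34191,9816093]` (class `258570bw`, (G-ord, `e = 2`) at `3`; twist `28730r2`, `a₃(V) = 1` — ANOMALOUS (outside the end state as typed); even line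
`φ = χ_{13}`): `x₀ = 10`, `D = 13`, `s = 1768`, `Ψ₂Sq(x₀) = 40635712` ⇒ `X3LineDatumThree W`. [folklore] -/
theorem x3LineDatumThree_258570bw2 : X3LineDatumThree (⟨1, -1, 0, 34191, 9816093⟩ : WeierstrassCurve ℚ) :=
  x3LineDatumThree_of_cert_of_delta _ (by norm_num [Δ, b₂, b₄, b₆, b₈]) 10 1768 13
    (by simp only [Ψ₃, eval_add, eval_mul, eval_pow, eval_C, eval_X, eval_ofNat]; norm_num [b₂, b₄, b₆, b₈])
    (X2.CellACertN9.squarefree_of_nodup_primeFactorsList_natAbs (by norm_num) (by simp [Nat.primeFactorsList_ofNat])) (by norm_num)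
    (by rw [KernelDisc.eval_Ψ₂Sq]; norm_num [b₂, b₄, b₆]) (by decide) (by decide) (by decide)

end Summit.BirchSwinnertonDyer.Rank1Residual.Additive.X3ThreeLineDatumRecords
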